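/-
Copyright (c) 2026 the pub-hodgecm-mathlib formalisation cell (harness21).  Prover seat hodgecm-mathlib-K2Liu-p11 (g0), Track B «K2-LIT»,
#184♮ = hLiu418 = `stmt-HodgeConjecture-24832`; LEAD F0P6-plan (g13) «M-157o» S5-W1-arch FILE 2, the last brick: holomorphy in `s` of the
even Whittaker integrals (differentiation under the integral), and the ODD-TYPE ASSEMBLY.  THEOREMS ONLY.
-/
import Summits.HodgeConjecture.HodgeConjecture.Theorems.K2LiuRankOneArchWhittakerEven   -- ★/📤 (this seat): recursion + even vanishing
import Mathlib.Analysis.Calculus.ParametricIntegral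
import HarnessLib

/-!
# Crux `HLiu418`, S5-W1-arch FILE 2 (second half): the even Whittaker integrals are holomorphic in `s`; all odd types vanish at the centre

Cell `hodgecm-mathlib`, crux item hLiu418 = `stmt-HodgeConjecture-24832` (helper lane `--supports`, count-neutral).

* §1 `log_onePlusSq_le` — `log(1+b²) ≤ δ⁻¹(1+b²)^δ`; norms of the even integrand and of its `s`-derivative.
* §2 `hasDerivAt_evenWhittaker` ∕ `differentiableOn_evenWhittaker (m : ℕ) (h : ℝ)` — `V_m(s) := ∫_ℝ (b−i)^{2m}(1+b²)^{−s−m−1}e^{−2πihb} db`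
  is holomorphic on `{−½ < re s}` (Mathlib `hasDerivAt_integral_of_dominated_loc_of_deriv_le`; domination by `(1+b²)^{−σ}`, `σ > ½`).
* §3 `evenWhittaker_eq_archScalarSection` — `V_m(s) = ∫ f⁰_{s+½, 2m}(J·n(b)) e^{−2πihb} db`, and at `s = 0` it is the ★ even integral
  `∫ f⁰_{½,2m} e`, which vanishes for `h < 0` (★ `integral_archScalarSection_even_half_eq_zero`).
With ★ `archScalarSection_succ_succ` (telescoping `W^{(2j+1)} = W^{(1)} − 2iΣ_{m≤j} V_m` on `re s > ½`), ★ FILE 1 (`E^{(1)}` entire, `E^{(1)}(0) = 0`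
for `h < 0`) and §2, the continued central value of EVERY odd type `k = 2j+1` vanishes for the wrong sign — §4 `oddWhittaker_closedForm`
(agreement on `re s > ½`), `differentiableOn_oddClosedForm` (`{−½ < re s}`), `oddWhittaker_centre_eq_zero_of_neg`.
References: [Bump1997, §1.6] (derived).
HONEST LABEL: HC_CM is proved only modulo the 7 printed citations (2 remaining named inputs: hLiu418 = stmt-HodgeConjecture-24832,
h413 = stmt-HodgeConjecture-24833) until rung 0 closes; count-neutral helper, closes no socket.
-/

set_option autoImplicit false
set_option linter.dupNamespace false

noncomputable section

open Complex MeasureTheory Set Filter Metric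
open scoped ComplexOrder Topology

namespace Summit.HodgeConjecture.HodgeConjecture.Cruxes.HLiu418.K2LiuRankOneArchWhittakerEvenHolomorphy

open Summit.HodgeConjecture.HodgeConjecture.Cruxes.HLiu418.K2LiuArchInducedTubeDefs
open Summit.HodgeConjecture.HodgeConjecture.Cruxes.HLiu418.K2LiuRankOneArchWhittakerCentre
open Summit.HodgeConjecture.HodgeConjecture.Cruxes.HLiu418.K2LiuRankOneArchWhittakerEven

/-! ## §1  Pointwise estimates -/

/-- `‖b − i‖^{2m} = (1+b²)^m` for real `b`. [folklore] -/
theorem norm_sub_I_pow (b : ℝ) (m : ℕ) : ‖((b : ℂ) - I) ^ (2 * m)‖ = (1 + b ^ 2) ^ m := by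
  rw [norm_pow, pow_mul]
  congr 1
  rw [Complex.sq_norm, show ((b : ℂ) - I) = (b : ℂ) + (-1 : ℝ) * I by push_cast; ring, Complex.normSq_add_mul_I]
  ring

/-- `log(1+b²) ≤ δ⁻¹·(1+b²)^δ` for `δ > 0`. [folklore] -/
theorem log_onePlusSq_le (b : ℝ) {δ : ℝ} (hδ : 0 < δ) : Real.log (1 + b ^ 2) ≤ δ⁻¹ * (1 + b ^ 2) ^ δ := by
  have h := Real.log_le_rpow_div (x := 1 + b ^ 2) (by positivity) hδ
  rw [div_eq_inv_mul] at h
  exact h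

/-- The even integrand `(b−i)^{2m}(1+b²)^{−s−m−1}e^{−2πihb}` has norm `(1+b²)^{−re s−1}`. [folklore] -/
theorem norm_evenIntegrand (m : ℕ) (s : ℂ) (h b : ℝ) :
    ‖((b : ℂ) - I) ^ (2 * m) * (((1 + b ^ 2 : ℝ)) : ℂ) ^ (-s - m - 1) * Complex.exp (-(2 * Real.pi * I * h * b))‖ =
      (1 + b ^ 2) ^ (-s.re - 1) := by
  have hph : ‖Complex.exp (-(2 * Real.pi * I * h * b))‖ = 1 := by
    rw [Complex.norm_exp]
    simp
  have h1 : 0 < 1 + b ^ 2 := by positivity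
  rw [norm_mul, norm_mul, hph, mul_one, norm_sub_I_pow, Complex.norm_cpow_eq_rpow_re_of_pos h1]
  simp only [Complex.sub_re, Complex.neg_re, Complex.natCast_re, Complex.one_re]
  rw [show (m : ℝ) = ((m : ℕ) : ℝ) by rfl, ← Real.rpow_natCast, ← Real.rpow_add h1]
  congr 1
  ring

/-! ## §2  Holomorphy of the even Whittaker integrals on `{−½ < re s}` -/

/-- **`V_m(s) = ∫ (b−i)^{2m}(1+b²)^{−s−m−1}e^{−2πihb} db` HAS A COMPLEX DERIVATIVE at every `s₀` with `−½ < re s₀`**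
(differentiation under the integral sign, dominated on a ball by `C·(1+b²)^{−σ}`, `σ > ½`). [folklore] -/
theorem hasDerivAt_evenWhittaker (m : ℕ) (h : ℝ) {s₀ : ℂ} (hs₀ : -(1 / 2) < s₀.re) :
    ∃ D : ℂ, HasDerivAt (fun s : ℂ => ∫ b : ℝ, ((b : ℂ) - I) ^ (2 * m) * (((1 + b ^ 2 : ℝ)) : ℂ) ^ (-s - m - 1) *
      Complex.exp (-(2 * Real.pi * I * h * b))) D s₀ := by
  -- radii
  obtain ⟨ε, hε, hε'⟩ : ∃ ε : ℝ, 0 < ε ∧ 1 / 2 < s₀.re + 1 - 2 * ε := ⟨(s₀.re + 1 / 2) / 4, by linarith, by linarith⟩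
  set F : ℂ → ℝ → ℂ := fun s b => ((b : ℂ) - I) ^ (2 * m) * (((1 + b ^ 2 : ℝ)) : ℂ) ^ (-s - m - 1) *
    Complex.exp (-(2 * Real.pi * I * h * b)) with hF
  set F' : ℂ → ℝ → ℂ := fun s b => ((b : ℂ) - I) ^ (2 * m) * ((((1 + b ^ 2 : ℝ)) : ℂ) ^ (-s - m - 1) *
    Complex.log (((1 + b ^ 2 : ℝ)) : ℂ) * (-1)) * Complex.exp (-(2 * Real.pi * I * h * b)) with hF'
  have hcont : ∀ s : ℂ, Continuous (F s) := by
    intro s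
    simp only [hF]
    refine Continuous.mul (Continuous.mul (by fun_prop) ?_) (by fun_prop)
    exact (Complex.continuous_ofReal.comp (by fun_prop)).cpow continuous_const fun b => Complex.ofReal_mem_slitPlane.2 (by positivity)
  have hcont' : Continuous (F' s₀) := by
    simp only [hF']
    refine Continuous.mul (Continuous.mul (by fun_prop) (Continuous.mul (Continuous.mul ?_ ?_) continuous_const)) (by fun_prop)
    · exact (Complex.continuous_ofReal.comp (by fun_prop)).cpow continuous_const fun b => Complex.ofReal_mem_slitPlane.2 (by positivity)
    · exact Continuous.clog (Complex.continuous_ofReal.comp (by fun_prop)) fun b => Complex.ofReal_mem_slitPlane.2 (by positivity)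
  -- the dominating function
  set bound : ℝ → ℝ := fun b => ε⁻¹ * (1 + b ^ 2) ^ (-(s₀.re + 1 - 2 * ε)) with hbound
  have hbound_int : Integrable bound := (integrable_onePlusSq_rpow hε').const_mul _
  have key := hasDerivAt_integral_of_dominated_loc_of_deriv_le (μ := volume) (F := F) (F' := F') (x₀ := s₀) (bound := bound)
    (s := ball s₀ ε) (ball_mem_nhds s₀ hε) (Filter.Eventually.of_forall fun s => (hcont s).aestronglyMeasurable) ?_
    hcont'.aestronglyMeasurable ?_ hbound_int ?_
  · exact ⟨_, key.2⟩
  · -- integrability at `s₀`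
    have hσ : 1 / 2 < s₀.re + 1 := by linarith
    refine Integrable.mono' (integrable_onePlusSq_rpow hσ) (hcont s₀).aestronglyMeasurable (Filter.Eventually.of_forall fun b => ?_)
    simp only [hF]
    rw [norm_evenIntegrand]
    apply le_of_eq
    congr 1
    ring
  · -- the bound on the ball
    refine Filter.Eventually.of_forall fun b s hs => ?_
    have h1 : 0 < 1 + b ^ 2 := by positivity
    have h1' : (1 : ℝ) ≤ 1 + b ^ 2 := by nlinarith [sq_nonneg b]
    have hre : s₀.re - ε < s.re := by
      have hd : ‖s - s₀‖ < ε := mem_ball_iff_norm.1 hs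
      have := abs_re_le_norm (s - s₀)
      rw [Complex.sub_re] at this
      have := (abs_lt.1 (lt_of_le_of_lt this hd)).1
      linarith
    simp only [hF', hbound]
    have hph : ‖Complex.exp (-(2 * Real.pi * I * h * b))‖ = 1 := by
      rw [Complex.norm_exp]
      simp
    have hlog : ‖Complex.log (((1 + b ^ 2 : ℝ)) : ℂ)‖ = Real.log (1 + b ^ 2) := by
      rw [← Complex.ofReal_log h1.le, Complex.norm_real, Real.norm_eq_abs, abs_of_nonneg (Real.log_nonneg h1')]
    rw [norm_mul, norm_mul, hph, mul_one, norm_mul, norm_mul, norm_neg, norm_one, mul_one, norm_sub_I_pow,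
      Complex.norm_cpow_eq_rpow_re_of_pos h1, hlog]
    simp only [Complex.sub_re, Complex.neg_re, Complex.natCast_re, Complex.one_re]
    -- `(1+b²)^m (1+b²)^{-re s - m - 1} log(1+b²) ≤ ε⁻¹ (1+b²)^{-(re s₀ + 1 - 2ε)}`
    have hpow : (1 + b ^ 2) ^ m * (1 + b ^ 2) ^ (-s.re - (m : ℝ) - 1) = (1 + b ^ 2) ^ (-s.re - 1) := by
      rw [← Real.rpow_natCast, ← Real.rpow_add h1]
      congr 1
      ring
    rw [← mul_assoc, hpow]
    have hlogle := log_onePlusSq_le b hε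
    have hmono : (1 + b ^ 2) ^ (-s.re - 1) ≤ (1 + b ^ 2) ^ (-(s₀.re - ε) - 1) :=
      Real.rpow_le_rpow_of_exponent_le h1' (by linarith)
    calc (1 + b ^ 2) ^ (-s.re - 1) * Real.log (1 + b ^ 2)
        ≤ (1 + b ^ 2) ^ (-(s₀.re - ε) - 1) * (ε⁻¹ * (1 + b ^ 2) ^ ε) :=
          mul_le_mul hmono hlogle (Real.log_nonneg h1') (Real.rpow_nonneg h1.le _)
      _ = ε⁻¹ * (1 + b ^ 2) ^ (-(s₀.re + 1 - 2 * ε)) := by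
          rw [mul_comm, mul_assoc, ← Real.rpow_add h1]
          congr 2
          ring
  · -- pointwise derivative in `s`
    refine Filter.Eventually.of_forall fun b s _ => ?_
    simp only [hF, hF']
    have h0 : (((1 + b ^ 2 : ℝ)) : ℂ) ≠ 0 := by exact_mod_cast (show (1 + b ^ 2 : ℝ) ≠ 0 by positivity)
    have hlin : HasDerivAt (fun s : ℂ => -s - m - 1) (-1) s := by
      have := ((hasDerivAt_id s).neg.sub_const (m : ℂ)).sub_const 1
      simpa using this
    have hc := hlin.const_cpow (c := (((1 + b ^ 2 : ℝ)) : ℂ)) (Or.inl h0)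
    exact (hc.const_mul _).mul_const _

/-- **HOLOMORPHY OF THE EVEN WHITTAKER INTEGRALS**: `s ↦ ∫ (b−i)^{2m}(1+b²)^{−s−m−1}e^{−2πihb} db` is holomorphic on `{−½ < re s}`. -/
theorem differentiableOn_evenWhittaker (m : ℕ) (h : ℝ) :
    DifferentiableOn ℂ (fun s : ℂ => ∫ b : ℝ, ((b : ℂ) - I) ^ (2 * m) * (((1 + b ^ 2 : ℝ)) : ℂ) ^ (-s - m - 1) *
      Complex.exp (-(2 * Real.pi * I * h * b))) {s : ℂ | -(1 / 2) < s.re} := by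
  intro s hs
  obtain ⟨D, hD⟩ := hasDerivAt_evenWhittaker m h hs
  exact hD.differentiableAt.differentiableWithinAt

/-! ## §3  The even integrals in scalar-section currency -/

/-- `f⁰_{s+½,2m}(J·n(b)) = (b−i)^{2m}(1+b²)^{−s−m−1}` on `U(1,1)`'s big cell. [folklore] -/
theorem archScalarSection_even_shift (m : ℕ) (s : ℂ) (b : ℝ) :
    archScalarSection (2 * (m : ℤ)) (s + 1 / 2) (Matrix.J (Fin 1) ℂ * Matrix.fromBlocks 1 ((b : ℂ) • (1 : Matrix (Fin 1) (Fin 1) ℂ)) 0 1) =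
      ((b : ℂ) - I) ^ (2 * m) * (((1 + b ^ 2 : ℝ)) : ℂ) ^ (-s - m - 1) := by
  have hz := ofReal_add_I_ne_zero b
  have hn0 : ((‖(b : ℂ) + I‖ : ℝ) : ℂ) ≠ 0 := by exact_mod_cast (norm_ofReal_add_I_pos b).ne'
  have h0 : (((1 + b ^ 2 : ℝ)) : ℂ) ≠ 0 := by exact_mod_cast (show (1 + b ^ 2 : ℝ) ≠ 0 by positivity)
  rw [archScalarSection_J_transl_fin_one]
  push_cast
  -- `|b+i|^{2m − 2s − 2} = (1+b²)^{m − s − 1}` and `(b+i)^{−2m}(1+b²)^m = (b−i)^{2m}·(1+b²)^0`… organise via `(1+b²) = (b+i)(b−i)`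
  have hnorm : ((‖(b : ℂ) + I‖ : ℝ) : ℂ) ^ ((2 : ℂ) * (m : ℂ) - 2 * (s + 1 / 2) - 1) = (((1 + b ^ 2 : ℝ)) : ℂ) ^ ((m : ℂ) - s - 1) := by
    rw [show ((2 : ℂ) * (m : ℂ) - 2 * (s + 1 / 2) - 1) = -(2 * (s + 1 - m)) by ring, norm_add_I_cpow]
    congr 1
    ring
  have hsplit : (((1 + b ^ 2 : ℝ)) : ℂ) ^ ((m : ℂ) - s - 1) =
      (((1 + b ^ 2 : ℝ)) : ℂ) ^ (2 * m : ℕ) * (((1 + b ^ 2 : ℝ)) : ℂ) ^ (-s - m - 1) := by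
    rw [← Complex.cpow_natCast, ← Complex.cpow_add _ _ h0]
    congr 1
    push_cast
    ring
  have hfac : (((1 + b ^ 2 : ℝ)) : ℂ) ^ (2 * m : ℕ) = ((b : ℂ) + I) ^ (2 * m) * ((b : ℂ) - I) ^ (2 * m) := by
    rw [← mul_pow]
    congr 1
    push_cast
    linear_combination I_mul_I
  rw [hnorm, hsplit, hfac, show (2 * (m : ℤ)) = ((2 * m : ℕ) : ℤ) by push_cast; ring, zpow_neg, zpow_natCast]
  have hu : ((b : ℂ) + I) ^ (2 * m) ≠ 0 := pow_ne_zero _ hz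
  field_simp
  simp only [Complex.ofReal_add, Complex.ofReal_one, Complex.ofReal_pow]

/-- **THE EVEN WHITTAKER INTEGRAL in scalar-section currency**: `V_m(s) = ∫ f⁰_{s+½,2m}(J·n(b))·e^{−2πihb} db`. -/
theorem evenWhittaker_eq_archScalarSection (m : ℕ) (s : ℂ) (h : ℝ) :
    ∫ b : ℝ, ((b : ℂ) - I) ^ (2 * m) * (((1 + b ^ 2 : ℝ)) : ℂ) ^ (-s - m - 1) * Complex.exp (-(2 * Real.pi * I * h * b)) =
      ∫ b : ℝ, archScalarSection (2 * (m : ℤ)) (s + 1 / 2) (Matrix.J (Fin 1) ℂ * Matrix.fromBlocks 1 ((b : ℂ) • (1 : Matrix (Fin 1) (Fin 1) ℂ)) 0 1) *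
        Complex.exp (-(2 * Real.pi * I * h * b)) := by
  refine integral_congr_ae (Filter.Eventually.of_forall fun b => ?_)
  simp only [archScalarSection_even_shift]

/-- **AT `s = 0` THE EVEN INTEGRAL VANISHES FOR THE WRONG SIGN** (`m ≥ 1`, `h < 0`; ★ Paley–Wiener instance). -/
theorem evenWhittaker_zero_eq_zero {m : ℕ} (hm : 1 ≤ m) {h : ℝ} (hh : h < 0) :
    ∫ b : ℝ, ((b : ℂ) - I) ^ (2 * m) * (((1 + b ^ 2 : ℝ)) : ℂ) ^ (-(0 : ℂ) - m - 1) * Complex.exp (-(2 * Real.pi * I * h * b)) = 0 := by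
  rw [evenWhittaker_eq_archScalarSection, zero_add]
  exact integral_archScalarSection_even_half_eq_zero hm hh

/-- The even integrand is integrable for `−½ < re s`. [folklore] -/
theorem integrable_evenIntegrand (m : ℕ) {s : ℂ} (hs : -(1 / 2) < s.re) (h : ℝ) :
    Integrable fun b : ℝ => ((b : ℂ) - I) ^ (2 * m) * (((1 + b ^ 2 : ℝ)) : ℂ) ^ (-s - m - 1) * Complex.exp (-(2 * Real.pi * I * h * b)) := by
  have hσ : 1 / 2 < s.re + 1 := by linarith
  have hcont : Continuous fun b : ℝ => ((b : ℂ) - I) ^ (2 * m) * (((1 + b ^ 2 : ℝ)) : ℂ) ^ (-s - m - 1) *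
      Complex.exp (-(2 * Real.pi * I * h * b)) := by
    refine Continuous.mul (Continuous.mul (by fun_prop) ?_) (by fun_prop)
    exact (Complex.continuous_ofReal.comp (by fun_prop)).cpow continuous_const fun b => Complex.ofReal_mem_slitPlane.2 (by positivity)
  refine Integrable.mono' (integrable_onePlusSq_rpow hσ) hcont.aestronglyMeasurable (Filter.Eventually.of_forall fun b => ?_)
  rw [norm_evenIntegrand]
  apply le_of_eq
  congr 1
  ring

/-! ## §4  All odd types: the telescoped closed form and the vanishing at the centre -/

/-- **POINTWISE TELESCOPING**: `f⁰_{s,2j+1}(J·n(b)) = f⁰_{s,1}(J·n(b)) − 2i·Σ_{m<j} f⁰_{s+½,2(m+1)}(J·n(b))`. -/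
theorem archScalarSection_odd_telescope (j : ℕ) (s : ℂ) (b : ℝ) :
    archScalarSection (2 * (j : ℤ) + 1) s (Matrix.J (Fin 1) ℂ * Matrix.fromBlocks 1 ((b : ℂ) • (1 : Matrix (Fin 1) (Fin 1) ℂ)) 0 1) =
      archScalarSection 1 s (Matrix.J (Fin 1) ℂ * Matrix.fromBlocks 1 ((b : ℂ) • (1 : Matrix (Fin 1) (Fin 1) ℂ)) 0 1) -
        2 * I * ∑ m ∈ Finset.range j,
          archScalarSection (2 * ((m + 1 : ℕ) : ℤ)) (s + 1 / 2) (Matrix.J (Fin 1) ℂ * Matrix.fromBlocks 1 ((b : ℂ) • (1 : Matrix (Fin 1) (Fin 1) ℂ)) 0 1) := by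
  induction j with
  | zero => simp
  | succ j ih =>
    rw [Finset.sum_range_succ, show (2 * ((j + 1 : ℕ) : ℤ) + 1) = (2 * (j : ℤ) + 1) + 2 by push_cast; ring, archScalarSection_succ_succ, ih,
      show (2 * (j : ℤ) + 1 + 1) = 2 * ((j + 1 : ℕ) : ℤ) by push_cast; ring]
    ring

/-- **THE ODD WHITTAKER INTEGRAL, TELESCOPED** (`re s > ½`):
`∫ f⁰_{s,2j+1}(J·n(b)) e db = ∫ f⁰_{s,1}(J·n(b)) e db − 2i·Σ_{m<j} V_{m+1}(s)`. -/
theorem oddWhittaker_telescope (j : ℕ) {s : ℂ} (hs : 1 / 2 < s.re) (h : ℝ) :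
    ∫ b : ℝ, archScalarSection (2 * (j : ℤ) + 1) s (Matrix.J (Fin 1) ℂ * Matrix.fromBlocks 1 ((b : ℂ) • (1 : Matrix (Fin 1) (Fin 1) ℂ)) 0 1) *
        Complex.exp (-(2 * Real.pi * I * h * b)) =
      (∫ b : ℝ, archScalarSection 1 s (Matrix.J (Fin 1) ℂ * Matrix.fromBlocks 1 ((b : ℂ) • (1 : Matrix (Fin 1) (Fin 1) ℂ)) 0 1) *
        Complex.exp (-(2 * Real.pi * I * h * b))) -
        2 * I * ∑ m ∈ Finset.range j, ∫ b : ℝ, ((b : ℂ) - I) ^ (2 * (m + 1)) * (((1 + b ^ 2 : ℝ)) : ℂ) ^ (-s - ((m + 1 : ℕ) : ℂ) - 1) *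
          Complex.exp (-(2 * Real.pi * I * h * b)) := by
  have hs0 : s ≠ 0 := by
    intro h0
    rw [h0, Complex.zero_re] at hs
    linarith
  have hs' : -(1 / 2) < s.re := by linarith
  -- integrability of the `k = 1` integrand (★ FILE 1 pieces) and of the even ones
  have hI1 : Integrable fun b : ℝ => archScalarSection 1 s (Matrix.J (Fin 1) ℂ * Matrix.fromBlocks 1 ((b : ℂ) • (1 : Matrix (Fin 1) (Fin 1) ℂ)) 0 1) *
      Complex.exp (-(2 * Real.pi * I * h * b)) := by
    have hs1 : 1 / 2 < (s + 1).re := by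
      rw [Complex.add_re, Complex.one_re]
      linarith
    have hA : Integrable fun β : ℝ => (β : ℂ) * (((1 + β ^ 2 : ℝ)) : ℂ) ^ (-s - 1) * Complex.exp (-(2 * Real.pi * Complex.I * h * β)) := by
      have hi := (integrable_moment_mul_phase hs h).const_mul ((-2 * s)⁻¹)
      refine hi.congr (Filter.Eventually.of_forall fun β => ?_)
      have h2s : (-2 : ℂ) * s ≠ 0 := mul_ne_zero (by norm_num) hs0
      field_simp
    have hB : Integrable fun β : ℝ => I * ((((1 + β ^ 2 : ℝ)) : ℂ) ^ (-(s + 1)) * Complex.exp (-(2 * Real.pi * Complex.I * h * β))) :=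
      (integrable_symbol_mul_phase hs1 h).const_mul I
    refine (hA.sub hB).congr (Filter.Eventually.of_forall fun β => ?_)
    simp only [Pi.sub_apply, integrand_fin_one, mul_zero, zero_add]
  have hIm : ∀ m ∈ Finset.range j, Integrable fun b : ℝ => ((b : ℂ) - I) ^ (2 * (m + 1)) *
      (((1 + b ^ 2 : ℝ)) : ℂ) ^ (-s - ((m + 1 : ℕ) : ℂ) - 1) * Complex.exp (-(2 * Real.pi * I * h * b)) :=
    fun m _ => integrable_evenIntegrand (m + 1) hs' h
  -- telescope pointwise, then integrate term by term
  have hpt : (fun b : ℝ => archScalarSection (2 * (j : ℤ) + 1) s (Matrix.J (Fin 1) ℂ * Matrix.fromBlocks 1 ((b : ℂ) • (1 : Matrix (Fin 1) (Fin 1) ℂ)) 0 1) *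
        Complex.exp (-(2 * Real.pi * I * h * b))) =
      fun b : ℝ => archScalarSection 1 s (Matrix.J (Fin 1) ℂ * Matrix.fromBlocks 1 ((b : ℂ) • (1 : Matrix (Fin 1) (Fin 1) ℂ)) 0 1) *
          Complex.exp (-(2 * Real.pi * I * h * b)) -
        2 * I * ∑ m ∈ Finset.range j, ((b : ℂ) - I) ^ (2 * (m + 1)) * (((1 + b ^ 2 : ℝ)) : ℂ) ^ (-s - ((m + 1 : ℕ) : ℂ) - 1) *
          Complex.exp (-(2 * Real.pi * I * h * b)) := by
    funext b
    rw [archScalarSection_odd_telescope, sub_mul, Finset.mul_sum, Finset.mul_sum, Finset.sum_mul]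
    congr 1
    refine Finset.sum_congr rfl fun m _ => ?_
    rw [archScalarSection_even_shift]
    ring
  rw [hpt, integral_sub hI1 ((integrable_finsetSum (Finset.range j) hIm).const_mul (2 * I)), integral_const_mul,
    integral_finsetSum (Finset.range j) hIm]

/-- **HOLOMORPHY OF THE TELESCOPED CLOSED FORM on `{−½ < re s}`** (`h ≠ 0`): ★ FILE 1's entire `E^{(1)}_h` minus `2i·Σ V_{m+1}` (§2). -/
theorem differentiableOn_oddClosedForm (j : ℕ) {h : ℝ} (hh : h ≠ 0) :
    DifferentiableOn ℂ (fun s : ℂ => (Complex.Gamma (s + 1))⁻¹ * ((Real.sqrt Real.pi : ℝ) : ℂ) *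
      (-(Real.pi * Complex.I * h) * mellin (fun t : ℝ => Complex.exp (-(t : ℂ) - ((Real.pi ^ 2 * h ^ 2 : ℝ) : ℂ) / (t : ℂ))) (s - 1 / 2) -
        I * mellin (fun t : ℝ => Complex.exp (-(t : ℂ) - ((Real.pi ^ 2 * h ^ 2 : ℝ) : ℂ) / (t : ℂ))) (s + 1 / 2)) -
      2 * I * ∑ m ∈ Finset.range j, ∫ b : ℝ, ((b : ℂ) - I) ^ (2 * (m + 1)) * (((1 + b ^ 2 : ℝ)) : ℂ) ^ (-s - ((m + 1 : ℕ) : ℂ) - 1) *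
          Complex.exp (-(2 * Real.pi * I * h * b))) {s : ℂ | -(1 / 2) < s.re} := by
  refine ((differentiable_archLineWhittakerClosedForm hh).differentiableOn).sub ?_
  refine DifferentiableOn.fun_sum (u := Finset.range j) (fun m _ => differentiableOn_evenWhittaker (m + 1) h) |>.const_mul (2 * I) |>.congr ?_
  intro s _
  rfl

/-- **THE ODD WHITTAKER INTEGRAL EQUALS THE CLOSED FORM on `re s > ½`**. -/
theorem oddWhittaker_closedForm (j : ℕ) {s : ℂ} (hs : 1 / 2 < s.re) (h : ℝ) :
    ∫ b : ℝ, archScalarSection (2 * (j : ℤ) + 1) s (Matrix.J (Fin 1) ℂ * Matrix.fromBlocks 1 ((b : ℂ) • (1 : Matrix (Fin 1) (Fin 1) ℂ)) 0 1) *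
        Complex.exp (-(2 * Real.pi * I * h * b)) =
      (Complex.Gamma (s + 1))⁻¹ * ((Real.sqrt Real.pi : ℝ) : ℂ) *
        (-(Real.pi * Complex.I * h) * mellin (fun t : ℝ => Complex.exp (-(t : ℂ) - ((Real.pi ^ 2 * h ^ 2 : ℝ) : ℂ) / (t : ℂ))) (s - 1 / 2) -
          I * mellin (fun t : ℝ => Complex.exp (-(t : ℂ) - ((Real.pi ^ 2 * h ^ 2 : ℝ) : ℂ) / (t : ℂ))) (s + 1 / 2)) -
        2 * I * ∑ m ∈ Finset.range j, ∫ b : ℝ, ((b : ℂ) - I) ^ (2 * (m + 1)) * (((1 + b ^ 2 : ℝ)) : ℂ) ^ (-s - ((m + 1 : ℕ) : ℂ) - 1) *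
          Complex.exp (-(2 * Real.pi * I * h * b)) := by
  rw [oddWhittaker_telescope j hs h, archLineWhittaker_eq hs h]

/-- **ALL ODD TYPES, WRONG SIGN: THE CONTINUED CENTRAL WHITTAKER VALUE VANISHES** (`a = +1`, `h < 0`, `k = 2j+1`):
the closed form of `oddWhittaker_closedForm`, holomorphic on `{−½ < re s}` (`differentiableOn_oddClosedForm`), is `0` at `s = 0`
(★ FILE 1 `archLineWhittaker_centre_eq_zero_of_neg` + the even integrals `V_{m+1}(0) = 0`, ★ Paley–Wiener). -/
theorem oddWhittaker_centre_eq_zero_of_neg (j : ℕ) {h : ℝ} (hh : h < 0) :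
    (Complex.Gamma ((0 : ℂ) + 1))⁻¹ * ((Real.sqrt Real.pi : ℝ) : ℂ) *
        (-(Real.pi * Complex.I * h) * mellin (fun t : ℝ => Complex.exp (-(t : ℂ) - ((Real.pi ^ 2 * h ^ 2 : ℝ) : ℂ) / (t : ℂ))) ((0 : ℂ) - 1 / 2) -
          I * mellin (fun t : ℝ => Complex.exp (-(t : ℂ) - ((Real.pi ^ 2 * h ^ 2 : ℝ) : ℂ) / (t : ℂ))) ((0 : ℂ) + 1 / 2)) -
        2 * I * ∑ m ∈ Finset.range j, ∫ b : ℝ, ((b : ℂ) - I) ^ (2 * (m + 1)) * (((1 + b ^ 2 : ℝ)) : ℂ) ^ (-(0 : ℂ) - ((m + 1 : ℕ) : ℂ) - 1) *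
          Complex.exp (-(2 * Real.pi * I * h * b)) = 0 := by
  rw [archLineWhittaker_centre_eq_zero_of_neg hh]
  have hV : ∀ m ∈ Finset.range j, ∫ b : ℝ, ((b : ℂ) - I) ^ (2 * (m + 1)) * (((1 + b ^ 2 : ℝ)) : ℂ) ^ (-(0 : ℂ) - ((m + 1 : ℕ) : ℂ) - 1) *
      Complex.exp (-(2 * Real.pi * I * h * b)) = 0 :=
    fun m _ => evenWhittaker_zero_eq_zero (m := m + 1) (by omega) hh
  rw [Finset.sum_eq_zero hV]
  ring

end Summit.HodgeConjecture.HodgeConjecture.Cruxes.HLiu418.K2LiuRankOneArchWhittakerEvenHolomorphy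

end
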